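import Summits.MatrixMultiplication.MatrixMultiplication.Theorems.AbelianSTPPCensusTAStatDDefs
import Summits.MatrixMultiplication.MatrixMultiplication.Theorems.AbelianSTPPCensusTAStatCRows
import Summits.MatrixMultiplication.MatrixMultiplication.Theorems.AbelianSTPPCensusTAStatLemmas

/-!
# T_A certificate, fourth range `6191 … 6379`: data facts and structural soundness

Cell mm-stpp (rung F-M1), T_A = `τ = 2.371`; checker `…TAStatDDefs.lean`. The third range's `…TAStatCRows.lean` at universe `6379` with: the bucket facts
IMPORTED from the third range through rfl-bridges (`bucketOf_eq`, `tb_eq`, `nb_eq_C` — same `TB`), the volume facts split in halves (kernel recursion),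
`m2V_sound` (completeness chunks of the second-member lists), and the walk now `TAStat2M.walk2` (soundness `TAStat2M.walk2_sound`, used in `…TAStatDSound.lean`).
Contents: data facts by evaluation (`levOf_spec`, `levOf_step`, `tb_step`, `tb_two`, `tb_sq`, `row_length`, `sentinel`), `tp_facts`, `mem_triplesS`,
`exists_sorted`, `domV_sound` / `checkV_sound` / `m2V_sound` / `domWrow_sound`, `mono_P_lev` / `mono_P_bkt` / `mono_W_lev`, `dominated`.
WHAT THIS IS NOT: arithmetic about the checker only; no statement about STPP families or `ω`.
-/

set_option linter.dupNamespace false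
set_option autoImplicit false

namespace Summit.MatrixMultiplication.MatrixMultiplication.Theorems.TAStatD

open TECert (tableOK vol us tableOK_iff)
open ShapeCert (gainOf2371i D)
open TAStatDData (E VL TB nl nb)
open TAStat (tm Entry e0 domP leP leW vpI p1I p2I p3I piece pcs vpCand vpThresh cover tm_sorted getD_drop_add pcs_sound)

/-! ## Facts about the concrete data (by evaluation) -/
set_option maxHeartbeats 2000000 in
/-- `levOf_spec`, lower half (the bounded quantifier is split to keep the kernel recursion shallow) -/
theorem levOf_spec_a : ∀ V ≤ 3200, levOf V < nl ∧ V ≤ VL.getD (levOf V) 0 := by decide +kernel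
set_option maxHeartbeats 2000000 in
/-- `levOf_spec`, upper half -/
theorem levOf_spec_b : ∀ k ≤ 3179, levOf (3200 + k) < nl ∧ 3200 + k ≤ VL.getD (levOf (3200 + k)) 0 := by decide +kernel
/-- every volume `V ≤ Mtop` has a level, and the level covers it -/
theorem levOf_spec : ∀ V ≤ 6379, levOf V < nl ∧ V ≤ VL.getD (levOf V) 0 := by
  intro V hV
  by_cases h : V ≤ 3200
  · exact levOf_spec_a V h
  · have := levOf_spec_b (V - 3200) (by omega)
    rwa [show 3200 + (V - 3200) = V by omega] at this
set_option maxHeartbeats 2000000 in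
/-- `levOf_step`, lower half -/
theorem levOf_step_a : ∀ V < 3200, levOf V ≤ levOf (V + 1) := by decide +kernel
set_option maxHeartbeats 2000000 in
/-- `levOf_step`, upper half -/
theorem levOf_step_b : ∀ k < 3179, levOf (3200 + k) ≤ levOf (3200 + k + 1) := by decide +kernel
/-- `levOf` is monotone, one step -/
theorem levOf_step : ∀ V < 6379, levOf V ≤ levOf (V + 1) := by
  intro V hV
  by_cases h : V < 3200
  · exact levOf_step_a V h
  · have := levOf_step_b (V - 3200) (by omega)
    rwa [show 3200 + (V - 3200) = V by omega] at this
/-- `levOf` is monotone on `[0, Mtop]` -/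
theorem levOf_mono {V V' : ℕ} (h : V ≤ V') (h' : V' ≤ 6379) : levOf V ≤ levOf V' := by
  induction V', h using Nat.le_induction with
  | base => exact le_rfl
  | succ n hn ih => exact (ih (by omega)).trans (levOf_step n (by omega))
/-- The bucket data of this range (`TAStatDData.TB`, 74 buckets, sentinel 362) are literally those of the third range, so the bucket facts are
imported from `AbelianSTPPCensusTAStatCRows.lean` through these definitional bridges. [bookkeeping] -/
theorem bucketOf_eq (t : ℕ) : TAStatD.bucketOf t = TAStatC.bucketOf t := rfl
/-- bridge for the bucket lower ends -/
theorem tb_eq (j : ℕ) : TAStatD.tb j = TAStatC.tb j := rfl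
/-- bridge for the number of buckets -/
theorem nb_eq_C : TAStatDData.nb = TAStatCData.nb := rfl
/-- every parameter `1 ≤ t ≤ 361` has a bucket `j < nb` with `TB[j] ≤ t < TB[j+1]` (from the third range) -/
theorem bucketOf_specD {t : ℕ} (ht : t ≤ 361) (h1 : 1 ≤ t) :
    TAStatD.bucketOf t < TAStatDData.nb ∧ TAStatD.tb (TAStatD.bucketOf t) ≤ t ∧ t < TAStatD.tb (TAStatD.bucketOf t + 1) := by
  simp only [bucketOf_eq, tb_eq, nb_eq_C]; exact TAStatC.bucketOf_spec t ht h1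
/-- `bucketOf` is monotone on `[0, 361]` (from the third range) -/
theorem bucketOf_monoD {t t' : ℕ} (h : t ≤ t') (h' : t' ≤ 361) : TAStatD.bucketOf t ≤ TAStatD.bucketOf t' := by
  simp only [bucketOf_eq]; exact TAStatC.bucketOf_mono h h'

/-- the bucket lower ends increase -/
theorem tb_step : ∀ j < TAStatDData.nb, TAStatD.tb j < TAStatD.tb (j + 1) := by decide +kernel

/-- … at most double -/
theorem tb_two : ∀ j < TAStatDData.nb, TAStatD.tb (j + 1) ≤ 2 * TAStatD.tb j := by decide +kernel

/-- … and at most square, from `3` on -/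
theorem tb_sq : ∀ j < TAStatDData.nb, 3 ≤ TAStatD.tb j → TAStatD.tb (j + 1) ≤ TAStatD.tb j * TAStatD.tb j := by decide +kernel

/-- the bucket lower ends are monotone -/
theorem tb_mono {j j' : ℕ} (h : j ≤ j') (h' : j' ≤ TAStatDData.nb) : TAStatD.tb j ≤ TAStatD.tb j' := by
  induction j', h using Nat.le_induction with
  | base => exact le_rfl
  | succ n hn ih => exact (ih (by omega)).trans (tb_step n (by omega)).le

/-- every row of the table has `nb` entries -/
theorem row_length : ∀ i < TAStatDData.nl, (TAStatDData.E.getD i []).length = TAStatDData.nb := by decide +kernel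

/-- the sentinel: `t³ ≤ Mtop²` forces `t ≤ 343 < TB[nb] = 362` -/
theorem sentinel {t : ℕ} (h : t ^ 3 ≤ 6379 ^ 2) : t ≤ 343 := by
  by_contra hc
  have h1 : 344 ^ 3 ≤ t ^ 3 := Nat.pow_le_pow_left (by omega) 3
  have h2 : (6379 : ℕ) ^ 2 < 344 ^ 3 := by norm_num
  omega

/-- numerals -/
theorem nl_eq : nl = 93 := rfl
/-- the budget parameters: `TP[j] = TB[j]` or `19 ≤ TP[j]`, and `TP[j] ≤ TB[j]` (read off `monoOK`) -/
theorem tp_facts (hmono : TAStatD.monoOK TAStatDData.nl TAStatDData.nb = true) :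
    ∀ j < TAStatDData.nb, (TAStatD.tp j = TAStatD.tb j ∨ 19 ≤ TAStatD.tp j) ∧ TAStatD.tp j ≤ TAStatD.tb j := by
  intro j hj
  simp only [monoOK, Bool.and_eq_true, List.all_eq_true, List.mem_range, Bool.or_eq_true, Nat.beq_eq, Nat.ble_eq,
    Nat.blt_eq] at hmono
  obtain ⟨-, h3⟩ := hmono
  obtain ⟨⟨-, h5⟩, h6⟩ := h3 j hj
  exact ⟨h5, h6⟩

/-! ## The candidate enumeration is complete for sorted candidates -/

/-- A sorted candidate shape is listed under its volume. [bookkeeping] -/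
theorem mem_triplesS {a b c : ℕ} (h : TAStatD.SCand (a, b, c)) : (a, b, c) ∈ TAStatD.triplesS (a * b * c) := by
  obtain ⟨ha, hab, hbc, ht⟩ := h
  simp only at ha hab hbc ht
  have hV : a * b * c ≤ 6379 := by
    have := (tableOK_iff _ _ _ _).1 ht
    exact this.1
  have hb : 1 ≤ b := le_trans ha hab
  have hc : 1 ≤ c := le_trans hb hbc
  have ha17 : a ≤ 18 := by
    by_contra hlt
    have h1 : 19 * 19 * 19 ≤ a * b * c :=
      Nat.mul_le_mul (Nat.mul_le_mul (by omega) (by omega)) (by omega)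
    omega
  have hb75 : b ≤ 79 := by
    by_contra hlt
    have h1 : 1 * 80 * 80 ≤ a * b * c := Nat.mul_le_mul (Nat.mul_le_mul ha (by omega)) (by omega)
    omega
  have hVa : a * b * c / a = b * c := by rw [mul_assoc]; exact Nat.mul_div_cancel_left _ (by omega)
  have hVab : b * c / b = c := Nat.mul_div_cancel_left _ (by omega)
  simp only [triplesS, List.mem_flatMap, List.mem_range]
  refine ⟨a - 1, by omega, ?_⟩
  rw [Nat.sub_add_cancel ha, if_pos (by rw [mul_assoc]; exact Nat.mul_mod_right _ _), List.mem_filterMap]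
  refine ⟨b - 1, by rw [List.mem_range]; omega, ?_⟩
  rw [Nat.sub_add_cancel hb, hVa, hVab]
  rw [if_pos ⟨by omega, Nat.mul_mod_right _ _, hbc, ht⟩]

/-! ## Sorted forms (this universe's `SCand`) -/

/-- Every shape with sizes `≥ 1` passing the table at `Mtop` has a sorted candidate form `y` with the same volume, pair-product sum and size sum,
whose first two entries are the smallest size and the smaller of the other two, in one of the three letter positions. [bookkeeping] -/
theorem exists_sorted (a b c : ℕ) (ha : 1 ≤ a) (hb : 1 ≤ b) (hc : 1 ≤ c) (ht : tableOK TAStatD.Mtop a b c = true) :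
    ∃ y : ℕ × ℕ × ℕ, TAStatD.SCand y ∧ vol y = a * b * c ∧ us y = a * b + b * c + c * a ∧ y.1 + y.2.1 + y.2.2 = a + b + c ∧
      ((y.1 = a ∧ y.2.1 = min c b ∧ a ≤ c ∧ a ≤ b) ∨ (y.1 = b ∧ y.2.1 = min a c ∧ b ≤ a ∧ b ≤ c) ∨
        (y.1 = c ∧ y.2.1 = min b a ∧ c ≤ b ∧ c ≤ a)) := by
  rcases le_total a b with hab | hab <;> rcases le_total b c with hbc | hbc <;> rcases le_total a c with hac | hac
  · exact ⟨(a, b, c), ⟨ha, hab, hbc, ht⟩, rfl, rfl, rfl, Or.inl ⟨rfl, by show b = min c b; rw [min_eq_right hbc], hac, hab⟩⟩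
  · exact ⟨(a, b, c), ⟨ha, hab, hbc, ht⟩, rfl, rfl, rfl, Or.inl ⟨rfl, by show b = min c b; rw [min_eq_right hbc], le_trans hab hbc, hab⟩⟩
  · exact ⟨(a, c, b), ⟨ha, hac, hbc, TALin1200.tableOK_swap23 ht⟩, by show a * c * b = a * b * c; ring,
      by show a * c + c * b + b * a = a * b + b * c + c * a; ring, by show a + c + b = a + b + c; ring,
      Or.inl ⟨rfl, by show c = min c b; rw [min_eq_left hbc], hac, hab⟩⟩
  · exact ⟨(c, a, b), ⟨hc, hac, hab, TALin1200.tableOK_swap23 (TALin1200.tableOK_swap13 ht)⟩, by show c * a * b = a * b * c; ring,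
      by show c * a + a * b + b * c = a * b + b * c + c * a; ring, by show c + a + b = a + b + c; ring,
      Or.inr (Or.inr ⟨rfl, by show a = min b a; rw [min_eq_right hab], le_trans hac hab, hac⟩)⟩
  · exact ⟨(b, a, c), ⟨hb, hab, hac, TALin1200.tableOK_swap12 ht⟩, by show b * a * c = a * b * c; ring,
      by show b * a + a * c + c * b = a * b + b * c + c * a; ring, by show b + a + c = a + b + c; ring,
      Or.inr (Or.inl ⟨rfl, by show a = min a c; rw [min_eq_left hac], hab, hbc⟩)⟩
  · exact ⟨(b, c, a), ⟨hb, hbc, hac, TALin1200.tableOK_swap23 (TALin1200.tableOK_swap12 ht)⟩, by show b * c * a = a * b * c; ring,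
      by show b * c + c * a + a * b = a * b + b * c + c * a; ring, by show b + c + a = a + b + c; ring,
      Or.inr (Or.inl ⟨rfl, by show c = min a c; rw [min_eq_right hac], hab, hbc⟩)⟩
  · exact ⟨(c, b, a), ⟨hc, hbc, hab, TALin1200.tableOK_swap13 ht⟩, by show c * b * a = a * b * c; ring,
      by show c * b + b * a + a * c = a * b + b * c + c * a; ring, by show c + b + a = a + b + c; ring,
      Or.inr (Or.inr ⟨rfl, by show b = min b a; rw [min_eq_left hab], hbc, le_trans hbc hab⟩)⟩
  · exact ⟨(c, b, a), ⟨hc, hbc, hab, TALin1200.tableOK_swap13 ht⟩, by show c * b * a = a * b * c; ring,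
      by show c * b + b * a + a * c = a * b + b * c + c * a; ring, by show c + b + a = a + b + c; ring,
      Or.inr (Or.inr ⟨rfl, by show b = min b a; rw [min_eq_left hab], hbc, hac⟩)⟩

/-! ## Unpacking the Boolean certificates -/

/-- `domV n V₀`: every listed shape of every volume of `[V₀, V₀+n)` is dominated. [bookkeeping] -/
theorem domV_sound : ∀ (n V₀ : ℕ), TAStatD.domV n V₀ = true → ∀ V, V₀ ≤ V → V < V₀ + n →
    ∀ x ∈ TAStatD.triplesS V, TAStatD.domX V (gainOf2371i V) x = true
  | 0, V₀, _, V, h1, h2, _, _ => by omega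
  | n + 1, V₀, h, V, h1, h2, x, hx => by
    have hunf : domV (n + 1) V₀ = ((triplesS V₀).all (domX V₀ (gainOf2371i V₀)) && domV n (V₀ + 1)) := rfl
    rw [hunf, Bool.and_eq_true] at h
    rcases Nat.eq_or_lt_of_le h1 with rfl | hlt
    · exact List.all_eq_true.1 h.1 x hx
    · exact domV_sound n (V₀ + 1) h.2 V hlt (by omega) x hx

/-- `checkV n V₀`: every listed shape of every volume of `[V₀, V₀+n)` passes `checkShape`. [bookkeeping] -/
theorem checkV_sound : ∀ (n V₀ : ℕ), TAStatD.checkV n V₀ = true → ∀ V, V₀ ≤ V → V < V₀ + n →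
    ∀ x ∈ TAStatD.triplesS V, TAStatD.checkShape V (gainOf2371i V) x = true
  | 0, V₀, _, V, h1, h2, _, _ => by omega
  | n + 1, V₀, h, V, h1, h2, x, hx => by
    have hunf : checkV (n + 1) V₀ = ((triplesS V₀).all (checkShape V₀ (gainOf2371i V₀)) && checkV n (V₀ + 1)) := rfl
    rw [hunf, Bool.and_eq_true] at h
    rcases Nat.eq_or_lt_of_le h1 with rfl | hlt
    · exact List.all_eq_true.1 h.1 x hx
    · exact checkV_sound n (V₀ + 1) h.2 V hlt (by omega) x hx

/-- `domWrow` along a dropped row: domination at every bucket `j′ ∈ [j, row.length)`. [bookkeeping] -/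
theorem domWrow_sound (g V p : ℕ) : ∀ (es : List Entry) (j : ℕ), TAStatD.domWrow g V p es j = true →
    ∀ k, k < es.length → V < TAStatD.tp (j + k) * p ∧ g * (es.getD k e0).2.2.2 ≤ (es.getD k e0).2.2.1 * (TAStatD.tp (j + k) * p - V)
  | [], j, _, k, hk => by simp at hk
  | e :: es, j, h, k, hk => by
    have hunf : domWrow g V p (e :: es) j =
        (Nat.blt V (tp j * p) && Nat.ble (g * e.2.2.2) (e.2.2.1 * (tp j * p - V)) && domWrow g V p es (j + 1)) := rfl
    rw [hunf, Bool.and_eq_true, Bool.and_eq_true, Nat.blt_eq, Nat.ble_eq] at h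
    obtain ⟨⟨h1, h2⟩, h3⟩ := h
    cases k with
    | zero => simpa using ⟨h1, h2⟩
    | succ k =>
      have hk' : k < es.length := by simpa using hk
      have := domWrow_sound g V p es (j + 1) h3 k hk'
      simpa [Nat.add_right_comm j 1 k, Nat.add_assoc] using this

/-- `m2V n V₀`: on the volumes `[V₀, V₀+n)` every listed sorted shape whose bucket (of `x.1·x.2.1`) is flagged lies in that bucket's second-member list. [bookkeeping] -/
theorem m2V_sound : ∀ (n V₀ : ℕ), TAStatD.m2V n V₀ = true → ∀ V, V₀ ≤ V → V < V₀ + n →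
    ∀ x ∈ TAStatD.triplesS V, TAStatD.m2f (TAStatD.bucketOf (x.1 * x.2.1)) = true → x ∈ TAStatD.m2l (TAStatD.bucketOf (x.1 * x.2.1))
  | 0, V₀, _, V, h1, h2, _, _, _ => by omega
  | n + 1, V₀, h, V, h1, h2, x, hx, hf => by
    have hunf : m2V (n + 1) V₀ = ((triplesS V₀).all (fun x => !(m2f (bucketOf (x.1 * x.2.1))) || (m2l (bucketOf (x.1 * x.2.1))).elem x) &&
        m2V n (V₀ + 1)) := rfl
    rw [hunf, Bool.and_eq_true] at h
    rcases Nat.eq_or_lt_of_le h1 with rfl | hlt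
    · have hx' := List.all_eq_true.1 h.1 x hx
      rw [Bool.or_eq_true, hf] at hx'
      rcases hx' with hneg | hel
      · simp at hneg
      · exact List.elem_iff.1 hel
    · exact m2V_sound n (V₀ + 1) h.2 V hlt (by omega) x hx hf

/-! ## Domination, packaged -/

/-- vM fraction transfer along levels: `leP (ent i j) (ent i' j)` for `i ≤ i' < nl`, `j < nb`. [bookkeeping] -/
theorem mono_P_lev (hmono : TAStatD.monoOK TAStatDData.nl TAStatDData.nb = true) {i i' j : ℕ} (hii : i ≤ i') (hi' : i' < nl) (hj : j < nb) :
    (TAStatD.ent i j).1 * (TAStatD.ent i' j).2.1 ≤ (TAStatD.ent i' j).1 * (TAStatD.ent i j).2.1 ∧ 1 ≤ (TAStatD.ent i' j).2.1 := by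
  have hrow : ∀ i < nl, ∀ j < nb, 1 ≤ (ent i j).2.1 ∧ 1 ≤ (ent i j).2.2.2 ∧
      (i + 1 < nl → leP (ent i j) (ent (i + 1) j) = true ∧ leW (ent i j) (ent (i + 1) j) = true) ∧
      (j + 1 < nb → leP (ent i j) (ent i (j + 1)) = true) := by
    intro i hi j hj
    simp only [monoOK, Bool.and_eq_true, List.all_eq_true, List.mem_range, Nat.beq_eq, Nat.ble_eq, Bool.or_eq_true] at hmono
    obtain ⟨⟨-, h2⟩, -⟩ := hmono
    obtain ⟨-, h3⟩ := h2 i hi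
    obtain ⟨⟨⟨hp, hw⟩, hi1⟩, hj1⟩ := h3 j hj
    refine ⟨hp, hw, fun hlt => ?_, fun hlt => ?_⟩
    · rcases hi1 with hge | hh
      · omega
      · exact hh
    · rcases hj1 with hge | hh
      · omega
      · exact hh
  induction i', hii using Nat.le_induction with
  | base => exact ⟨by rw [Nat.mul_comm], (hrow i hi' j hj).1⟩
  | succ n hn ih =>
    obtain ⟨h1, hp⟩ := ih (by omega)
    have hstep := ((hrow n (by omega) j hj).2.2.1 hi').1
    simp only [leP, Nat.ble_eq] at hstep
    refine ⟨?_, (hrow (n + 1) hi' j hj).1⟩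
    have key : (ent i j).1 * (ent (n + 1) j).2.1 * (ent n j).2.1 ≤ (ent (n + 1) j).1 * (ent i j).2.1 * (ent n j).2.1 := by
      calc (ent i j).1 * (ent (n + 1) j).2.1 * (ent n j).2.1 = (ent i j).1 * (ent n j).2.1 * (ent (n + 1) j).2.1 := by ring
        _ ≤ (ent n j).1 * (ent i j).2.1 * (ent (n + 1) j).2.1 := Nat.mul_le_mul_right _ h1
        _ = (ent n j).1 * (ent (n + 1) j).2.1 * (ent i j).2.1 := by ring
        _ ≤ (ent (n + 1) j).1 * (ent n j).2.1 * (ent i j).2.1 := Nat.mul_le_mul_right _ hstep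
        _ = (ent (n + 1) j).1 * (ent i j).2.1 * (ent n j).2.1 := by ring
    exact Nat.le_of_mul_le_mul_right key hp

/-- vM fraction transfer along buckets: `leP (ent i j) (ent i j')` for `j ≤ j' < nb`, `i < nl`. [bookkeeping] -/
theorem mono_P_bkt (hmono : TAStatD.monoOK TAStatDData.nl TAStatDData.nb = true) {i j j' : ℕ} (hjj : j ≤ j') (hj' : j' < nb) (hi : i < nl) :
    (TAStatD.ent i j).1 * (TAStatD.ent i j').2.1 ≤ (TAStatD.ent i j').1 * (TAStatD.ent i j).2.1 ∧ 1 ≤ (TAStatD.ent i j').2.1 := by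
  have hrow : ∀ j < nb, 1 ≤ (ent i j).2.1 ∧ (j + 1 < nb → leP (ent i j) (ent i (j + 1)) = true) := by
    intro j hj
    simp only [monoOK, Bool.and_eq_true, List.all_eq_true, List.mem_range, Nat.beq_eq, Nat.ble_eq, Bool.or_eq_true] at hmono
    obtain ⟨⟨-, h2⟩, -⟩ := hmono
    obtain ⟨-, h3⟩ := h2 i hi
    obtain ⟨⟨⟨hp, -⟩, -⟩, hj1⟩ := h3 j hj
    refine ⟨hp, fun hlt => ?_⟩
    rcases hj1 with hge | hh
    · omega
    · exact hh
  induction j', hjj using Nat.le_induction with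
  | base => exact ⟨by rw [Nat.mul_comm], (hrow j hj').1⟩
  | succ n hn ih =>
    obtain ⟨h1, hp⟩ := ih (by omega)
    have hstep := (hrow n (by omega)).2 hj'
    simp only [leP, Nat.ble_eq] at hstep
    refine ⟨?_, (hrow (n + 1) hj').1⟩
    have key : (ent i j).1 * (ent i (n + 1)).2.1 * (ent i n).2.1 ≤ (ent i (n + 1)).1 * (ent i j).2.1 * (ent i n).2.1 := by
      calc (ent i j).1 * (ent i (n + 1)).2.1 * (ent i n).2.1 = (ent i j).1 * (ent i n).2.1 * (ent i (n + 1)).2.1 := by ring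
        _ ≤ (ent i n).1 * (ent i j).2.1 * (ent i (n + 1)).2.1 := Nat.mul_le_mul_right _ h1
        _ = (ent i n).1 * (ent i (n + 1)).2.1 * (ent i j).2.1 := by ring
        _ ≤ (ent i (n + 1)).1 * (ent i n).2.1 * (ent i j).2.1 := Nat.mul_le_mul_right _ hstep
        _ = (ent i (n + 1)).1 * (ent i j).2.1 * (ent i n).2.1 := by ring
    exact Nat.le_of_mul_le_mul_right key hp

/-- U11-G fraction transfer along levels: `leW (ent i j) (ent i' j)` for `i ≤ i' < nl`, `j < nb`. [bookkeeping] -/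
theorem mono_W_lev (hmono : TAStatD.monoOK TAStatDData.nl TAStatDData.nb = true) {i i' j : ℕ} (hii : i ≤ i') (hi' : i' < nl) (hj : j < nb) :
    (TAStatD.ent i j).2.2.1 * (TAStatD.ent i' j).2.2.2 ≤ (TAStatD.ent i' j).2.2.1 * (TAStatD.ent i j).2.2.2 ∧ 1 ≤ (TAStatD.ent i' j).2.2.2 := by
  have hrow : ∀ i < nl, 1 ≤ (ent i j).2.2.2 ∧ (i + 1 < nl → leW (ent i j) (ent (i + 1) j) = true) := by
    intro i hi
    simp only [monoOK, Bool.and_eq_true, List.all_eq_true, List.mem_range, Nat.beq_eq, Nat.ble_eq, Bool.or_eq_true] at hmono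
    obtain ⟨⟨-, h2⟩, -⟩ := hmono
    obtain ⟨-, h3⟩ := h2 i hi
    obtain ⟨⟨⟨-, hw⟩, hi1⟩, -⟩ := h3 j hj
    refine ⟨hw, fun hlt => ?_⟩
    rcases hi1 with hge | hh
    · omega
    · exact hh.2
  induction i', hii using Nat.le_induction with
  | base => exact ⟨by rw [Nat.mul_comm], (hrow i hi').1⟩
  | succ n hn ih =>
    obtain ⟨h1, hp⟩ := ih (by omega)
    have hstep := (hrow n (by omega)).2 hi'
    simp only [leW, Nat.ble_eq] at hstep
    refine ⟨?_, (hrow (n + 1) hi').1⟩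
    have key : (ent i j).2.2.1 * (ent (n + 1) j).2.2.2 * (ent n j).2.2.2 ≤ (ent (n + 1) j).2.2.1 * (ent i j).2.2.2 * (ent n j).2.2.2 := by
      calc (ent i j).2.2.1 * (ent (n + 1) j).2.2.2 * (ent n j).2.2.2
          = (ent i j).2.2.1 * (ent n j).2.2.2 * (ent (n + 1) j).2.2.2 := by ring
        _ ≤ (ent n j).2.2.1 * (ent i j).2.2.2 * (ent (n + 1) j).2.2.2 := Nat.mul_le_mul_right _ h1
        _ = (ent n j).2.2.1 * (ent (n + 1) j).2.2.2 * (ent i j).2.2.2 := by ring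
        _ ≤ (ent (n + 1) j).2.2.1 * (ent n j).2.2.2 * (ent i j).2.2.2 := Nat.mul_le_mul_right _ hstep
        _ = (ent (n + 1) j).2.2.1 * (ent i j).2.2.2 * (ent n j).2.2.2 := by ring
    exact Nat.le_of_mul_le_mul_right key hp

/-- **Domination, packaged.**  With the table facts and the domination of every sorted candidate established (`monoOK`, `domV` on all volumes
`1 … Mtop`): a sorted candidate shape `x` of volume `≤ Vl ≤ Mtop` with `tm x ≤ t*` (`1 ≤ t* ≤ 343`) is dominated by the entry
`e = ent (levOf Vl) (bucketOf t*)` read at `t′ = tp (bucketOf t*)`: `g(vol x)·pP ≤ gP·us x`, `vol x < t′·us x`, `g(vol x)·wW ≤ gW·(t′·us x − vol x)`,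
with `pP, wW ≥ 1`. [original] -/
theorem dominated (hmono : TAStatD.monoOK TAStatDData.nl TAStatDData.nb = true)
    (hdom : ∀ V, 1 ≤ V → V ≤ 6379 → ∀ x ∈ TAStatD.triplesS V, TAStatD.domX V (gainOf2371i V) x = true)
    {x : ℕ × ℕ × ℕ} (hx : TAStatD.SCand x) {Vl ts : ℕ} (hVl : Vl ≤ 6379) (hxV : vol x ≤ Vl) (hts1 : 1 ≤ ts) (hts : ts ≤ 343)
    (hxt : tm x ≤ ts) :
    let e := ent (levOf Vl) (bucketOf ts)
    1 ≤ e.2.1 ∧ 1 ≤ e.2.2.2 ∧ gainOf2371i (vol x) * e.2.1 ≤ e.1 * us x ∧ vol x < tp (bucketOf ts) * us x ∧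
      gainOf2371i (vol x) * e.2.2.2 ≤ e.2.2.1 * (tp (bucketOf ts) * us x - vol x) := by
  intro e
  obtain ⟨a, b, c⟩ := x
  obtain ⟨ha, hab, hbc, ht⟩ := hx
  simp only at ha hab hbc ht
  have hvol : vol (a, b, c) = a * b * c := rfl
  have hV1 : 1 ≤ a * b * c := Nat.mul_pos (Nat.mul_pos ha (le_trans ha hab)) (le_trans (le_trans ha hab) hbc)
  have hVx : a * b * c ≤ 6379 := by rw [← hvol]; exact hxV.trans hVl
  have hmem : (a, b, c) ∈ triplesS (a * b * c) := mem_triplesS ⟨ha, hab, hbc, ht⟩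
  have hd := hdom (a * b * c) hV1 hVx _ hmem
  have htm : tm (a, b, c) = a * b := tm_sorted hab hbc
  set i₀ := levOf (a * b * c) with hi₀
  set j₀ := bucketOf (a * b) with hj₀
  set i := levOf Vl with hi
  set j := bucketOf ts with hj
  have hi₀i : i₀ ≤ i := levOf_mono (by rw [← hvol]; exact hxV) hVl
  have hinl : i < nl := (levOf_spec Vl hVl).1
  have hi₀nl : i₀ < nl := (levOf_spec _ hVx).1
  have htm1 : 1 ≤ a * b := Nat.mul_pos ha (le_trans ha hab)
  have htmts : a * b ≤ ts := by rw [← htm]; exact hxt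
  have hj₀j : j₀ ≤ j := bucketOf_monoD htmts (by omega)
  have hjs := bucketOf_specD (t := ts) (by omega) hts1
  have hjnb : j < nb := hjs.1
  have hj₀s := bucketOf_specD (t := a * b) (by omega) htm1
  simp only [domX, Bool.and_eq_true, htm] at hd
  obtain ⟨hP, hW⟩ := hd
  simp only [domP, Nat.ble_eq] at hP
  have hlen : (E.getD i₀ []).length = nb := row_length i₀ hi₀nl
  have hk : j - j₀ < ((E.getD i₀ []).drop j₀).length := by rw [List.length_drop, hlen]; omega
  have hW' := domWrow_sound _ _ _ _ _ hW (j - j₀) hk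
  rw [getD_drop_add, show j₀ + (j - j₀) = j by omega] at hW'
  change gainOf2371i (a * b * c) * (ent i₀ j₀).2.1 ≤ (ent i₀ j₀).1 * us (a, b, c) at hP
  change a * b * c < tp j * us (a, b, c) ∧ gainOf2371i (a * b * c) * (ent i₀ j).2.2.2 ≤ (ent i₀ j).2.2.1 * (tp j * us (a, b, c) - a * b * c)
    at hW'
  obtain ⟨hlt, hWd⟩ := hW'
  obtain ⟨hPj, hp1⟩ := mono_P_bkt hmono hj₀j hjnb hi₀nl
  obtain ⟨hPi, hp2⟩ := mono_P_lev hmono hi₀i hinl hjnb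
  obtain ⟨hWi, hw2⟩ := mono_W_lev hmono hi₀i hinl hjnb
  have hp0 : 1 ≤ (ent i₀ j₀).2.1 := (mono_P_bkt hmono le_rfl (by omega) hi₀nl).2
  have hw0 : 1 ≤ (ent i₀ j).2.2.2 := (mono_W_lev hmono le_rfl hi₀nl hjnb).2
  set g := gainOf2371i (a * b * c)
  set u := us (a, b, c)
  have hP1 : g * (ent i₀ j).2.1 ≤ (ent i₀ j).1 * u := by
    have key : g * (ent i₀ j).2.1 * (ent i₀ j₀).2.1 ≤ (ent i₀ j).1 * u * (ent i₀ j₀).2.1 := by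
      calc g * (ent i₀ j).2.1 * (ent i₀ j₀).2.1 = g * (ent i₀ j₀).2.1 * (ent i₀ j).2.1 := by ring
        _ ≤ (ent i₀ j₀).1 * u * (ent i₀ j).2.1 := Nat.mul_le_mul_right _ hP
        _ = (ent i₀ j₀).1 * (ent i₀ j).2.1 * u := by ring
        _ ≤ (ent i₀ j).1 * (ent i₀ j₀).2.1 * u := Nat.mul_le_mul_right _ hPj
        _ = (ent i₀ j).1 * u * (ent i₀ j₀).2.1 := by ring
    exact Nat.le_of_mul_le_mul_right key hp0
  have hP2 : g * (ent i j).2.1 ≤ (ent i j).1 * u := by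
    have key : g * (ent i j).2.1 * (ent i₀ j).2.1 ≤ (ent i j).1 * u * (ent i₀ j).2.1 := by
      calc g * (ent i j).2.1 * (ent i₀ j).2.1 = g * (ent i₀ j).2.1 * (ent i j).2.1 := by ring
        _ ≤ (ent i₀ j).1 * u * (ent i j).2.1 := Nat.mul_le_mul_right _ hP1
        _ = (ent i₀ j).1 * (ent i j).2.1 * u := by ring
        _ ≤ (ent i j).1 * (ent i₀ j).2.1 * u := Nat.mul_le_mul_right _ hPi
        _ = (ent i j).1 * u * (ent i₀ j).2.1 := by ring
    exact Nat.le_of_mul_le_mul_right key hp1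
  have hW2 : g * (ent i j).2.2.2 ≤ (ent i j).2.2.1 * (tp j * u - a * b * c) := by
    have key : g * (ent i j).2.2.2 * (ent i₀ j).2.2.2 ≤ (ent i j).2.2.1 * (tp j * u - a * b * c) * (ent i₀ j).2.2.2 := by
      calc g * (ent i j).2.2.2 * (ent i₀ j).2.2.2 = g * (ent i₀ j).2.2.2 * (ent i j).2.2.2 := by ring
        _ ≤ (ent i₀ j).2.2.1 * (tp j * u - a * b * c) * (ent i j).2.2.2 := Nat.mul_le_mul_right _ hWd
        _ = (ent i₀ j).2.2.1 * (ent i j).2.2.2 * (tp j * u - a * b * c) := by ring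
        _ ≤ (ent i j).2.2.1 * (ent i₀ j).2.2.2 * (tp j * u - a * b * c) := Nat.mul_le_mul_right _ hWi
        _ = (ent i j).2.2.1 * (tp j * u - a * b * c) * (ent i₀ j).2.2.2 := by ring
    exact Nat.le_of_mul_le_mul_right key hw0
  exact ⟨hp2, hw2, hP2, hlt, hW2⟩

end Summit.MatrixMultiplication.MatrixMultiplication.Theorems.TAStatD
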